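import Literature.MathematicalPhysics.QuantumFieldTheory.Balaban1983to89.B4Sect5Exhaustion

/-!
# `BalabanUV.Beta.GAN24.DirichletExhaustion` — binder row G-an2-4 / (CONV-C), part P2: B4's Sect. 5 DIRICHLET EXHAUSTION
# WITH AN EXPLICIT RATE — an operator-level η-rate passes to ALL Dirichlet inverse kernels on `Ω ⊆ ℤ^d`, linearly, with
# displayed constants; PART 1: shapes, the constant, finite and infinite volume (unit b2b-balaban-gan24-p2, gen 1, v1)

HONEST FRAMING (cell contract, verbatim): «discharging `BetaPertH` makes Bałaban's UV stability UNCONDITIONAL — a real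
constructive-QFT result; it is NOT the continuum limit and NOT the Clay problem.»  (CONV-C) — the `k`-uniform exponential
decay AND the geometric one-step η-rate `|𝒦^{(k+1)} − 𝒦^{(k)}|(y,y′) ≤ C₄θ^k e^{−δ₄|y−y′|}` of the unit-lattice constituent
kernels of the one-loop step at `U = 1` (cell file `BETA/AN2.md` §6; binder row G-an2-4 of `BINDER-OWNERS.md`) — is an OPEN
analytic input of the β-function wall ((M2⁺) drift form) and is NOT IN PRINT: [Balaban1987RG1] p. 264 defers the
perturbative properties of the flow to «a separate paper» that did not appear; the series prints `k`-UNIFORM bounds only.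
THIS MODULE is the RATE-TRANSFER HALF of (CONV-C) for constituents that are INVERSES of unit-lattice operators
(the fluctuation covariance `C^{(k)} = (C*Δ_kC)⁻¹`-type objects of [Balaban1984PropagatorsII] (2.156)): an η-rate of the
OPERATORS `A_k` implies the η-rate of every Dirichlet inverse kernel `(A_k)_Λ⁻¹`, `Λ ⊆ Ω ⊆ ℤ^d` arbitrary (infinite volume
included), with the SAME geometric ratio `θ` and constants that are displayed functions of B4's `(γ₀, c₀, δ₀)` and `(d, N)`.
It discharges NOTHING of `BetaPertH`; it instantiates no binder of the wall; NOT continuum, NOT Clay.  «not in print; our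
proof attempt» (cell label): the transfer is [folklore] resolvent calculus made quantitative inside B4's own theorem.

ABSOLUTE RULE (cell, verbatim): «No internally-minted statement may enter as a cited fact. Every hypothesis is either
kernel-proved in this package or a verbatim quotation of a PUBLISHED theorem with page reference. The manuscript(s) under
audit are NOT citable for their own disputed steps — they are the thing under adjudication; programme-internal
(2001/route/tribunal) claims are never citable.»  Every theorem below is kernel-proved from explicit hypotheses on abstract
kernels `A : (ℤ^d × Fin N) → (ℤ^d × Fin N) → ℝ`; the three `def … : Prop` of §0 are HYPOTHESIS / TARGET SHAPES ([shape]),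
asserted of nothing; nothing below says that any kernel IS Bałaban's.

PLACEMENT.  New cell work (our theorem about the cell's typed objects), hence under the registered cell topic
`Summits/QuantumFields/BalabanUV/Beta/` (LEAN PLACEMENT RULE, human 2026-08-19; sub-directory `GAN24/` = the three disjoint
technique files of the G-an2-4 prover sub-cell, coordinator 2026-08-19T21:15Z: `CombesThomas` (p1), `DirichletExhaustion`
(p2, this file), `WoodburyFibre` (p3)).  It IMPORTS ONLY `Literature/…/Balaban1983to89/B4Sect5Exhaustion` (unit pv23-g7,
p-accepted; through it `B4Sect5Proof`, pv23-g3, and `B4`, b04) and is imported by nothing under `Literature/`.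

## What is printed (verbatim; locations only — nothing printed is used as a hypothesis)

* [Balaban1983RegularityDecay] = T. Bałaban, *Regularity and decay of lattice Green's functions*, Commun. Math. Phys. **89**
  (1983) 571–597 (cell paper B4), Sect. 5 Theorem p. 594: *«Let Ω ⊂ Z^d and let A be a symmetric operator … A ≥ γ₀I,
  |A(x,x′)| ≤ c₀e^{−δ₀|x−x′|}, x, x′ ∈ Ω. (5.6) Then there exist positive constants c₁, δ₁ such that for arbitrary Λ ⊂ Ω
  and for C_Λ = A_Λ^{−1} … |C_Λ(x,x′)| ≤ c₁e^{−δ₁|x−x′|}, x, x′ ∈ Λ, (5.7) … If we perturb the operator A by an operator B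
  such that the condition (5.6) is satisfied for A + B, and additionally B has the property |B(x,x′)| ≤
  c₀e^{−δ₀(|x−x′| + dist(x,Ω^c) + dist(x′,Ω^c))}, x, x′ ∈ Ω, (5.9) then we have also |A_Λ^{−1}(x,x′) − (A+B)_Λ^{−1}(x,x′)|
  ≤ c₁e^{−δ₁(|x−x′| + dist(x,Ω^c) + dist(x′,Ω^c))}, x, x′ ∈ Λ. (5.10)»*; p. 597: *«A′_{□′_j}^{−1} − A_{□_j}^{−1} = … −
  A′_{□′_j}^{−1}B_{□′_j}A_{□′_j}^{−1}, (5.26)»* and *«The constants δ₁, c₁ are functions of δ₀, γ₀, c₀, and from the above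
  proof we can get more precise estimates for them.»* (renders `b2b-balaban-ref1/pages/1983-cmp89-regularity-decay/…-p024/
  p027-x2.png`; quotations as certified in `B4Sect5Proof` / `B4Sect5Exhaustion`).  In the tree: `B4Sect5Proof.sect5_explicit`
  (finite `Ω`, EXPLICIT `cStar`, `deltaStar`), `B4Sect5Exhaustion.sect5ThmSetOmega_holds` (arbitrary `Ω ⊆ ℤ^d`, the inverse
  kernel `limInv Λ A` of every `Λ ⊆ Ω` as the entrywise limit of the Dirichlet compressions `A_{Λ ∩ [−n,n]^d}⁻¹`).
* [Balaban1984PropagatorsII] = T. Bałaban, *Propagators and renormalization transformations for lattice gauge theories. II*,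
  Commun. Math. Phys. **96** (1984) 223–250 (B6), p. 250: *«C^{(k)}_Λ = C(C*Δ_kC)^{−1}C*. (2.156) … ⟨B′, C*Δ_kCB′⟩ ≥ …
  ≥ γ′₀‖B′‖², (2.157) where γ′₀ = (γ₀/12d²)L^{−d−1}. C is a short-ranged operator, so C*Δ_kC has the same exponential decay
  as Δ_k. Now we may apply the theory developed in Sect. 5 of [3] on unit lattice operators. It gives us an exponential decay,
  and all the other properties, for the operator (C*Δ_kC)^{−1}, hence for C^{(k)}_Λ also.»* — the USE SITE: the unit-lattice
  operators `A_k = C*Δ_kC` satisfy (5.6) with `k`-INDEPENDENT `(γ′₀, c₀, δ₀)` (printed, (2.157) + (1.67)); NO η-rate of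
  `Δ_k`, `C*Δ_kC` or `C^{(k)}` is printed anywhere in the series.
* [King1986] = C. King, *The U(1) Higgs model. I. The continuum limit*, Commun. Math. Phys. **102** (1986) 649–677 (TEMPLATE
  literature, not under audit), Lemma 4.5 p. 674: *«|C^{(k)}(x,y) − C^{(k+n)}(x,y)| ≤ CL^{−k}e^{−δ₀|x−y|}. (4.38)»* with the
  mechanism (4.39)–(4.41) pp. 674–675 (resolvent identity between two decaying covariances around a small decaying middle
  factor) — the printed ABELIAN precedent of exactly the transfer proved here (for King's scalar covariance (4.32) on a
  periodic box; tree: `King1986.CovarianceRate.triple_decay_bound` on finite index sets, `T4Cov2156Rate.redCov_rate`).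

## What this file proves (0 sorry; Mathlib + the single import BY NAME)

§0 SHAPES [shape]: `OpClose Ω A A′ ε δ₀` (operator closeness `|A′ − A| ≤ εe^{−δ₀|x−x′|}` on `Ω × Ω`), `OpFamilyRate Ω A γ₀ c₀ δ₀
θ₀ θ` (`k`-uniform (5.6) `Hyp56Z Ω (A k) γ₀ c₀ δ₀` + step closeness `θ₀θ^k`), and the TARGET `ConvC C C₄ δ₄ θ` = the two
clauses of (CONV-C) for one family of unit-lattice kernels.
§1 `rateConst d N γ₀ c₀ δ₀ = (2/γ₀)²·(N·K_d(δ₁/2))²` with `B4Sect5Proof.bigConst = c₀·rateConst` (`bigConst_eq_mul_rateConst`):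
the perturbation size enters B4's (5.10)-constant LINEARLY.
§2 `perturb_rate` (finite `Ω`, B4's literal matrices): (5.6) for `A, A′` + `|A′ − A| ≤ εe^{−δ₀|x−x′|}` ⟹
`|A_Λ⁻¹ − A′_Λ⁻¹|(x,x′) ≤ rateConst·ε·e^{−δ⋆|x−x′|}` for all `Λ ⊆ Ω` — the proof of `B4Sect5Proof.perturb_bound` ((5.26) +
(5.7) + uniform lattice sums) with the middle bound replaced.
§3 `limInv_sub_limInv_rate`: the same in INFINITE VOLUME for B4's exhaustion kernels `limInv Λ A`, every `Λ ⊆ Ω ⊆ ℤ^d`.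
(§4 families / operator limit / `dirichletExhaustion_rate` / `dirichletExhaustion_limit` and §5 non-vacuity: PART 2, the sibling
`GAN24/DirichletExhaustionFamily.lean`.)

CONSTANTS (all displayed): `δ⋆ = deltaStar = δ₁/4`, `c⋆ = cStar = max{2/γ₀, bigConst}`, `δ₁ = delta1 = min{δ₀/4, γ₀/(2M₀+1)}`,
`M₀ = c₀(4/δ₀)·N·K_d(δ₀/2)`, `K_d(a) = latticeConst d a = (2/(1−e^{−a/d}))^d` (all `B4Sect5Proof`), `rateConst` (§1);
the supplier's `(θ₀, θ)` enter linearly / as the ratio.  For Bałaban's `C^{(k)}(𝟙)` at `U = 1`: `γ₀ := γ′₀ = (γ₀/12d²)L^{−d−1}`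
of (2.157), so `rateConst ∝ L^{2(d+1)}·(N·K_d)²` and `δ⋆ ∝ L^{−(d+1)}/(c₀N·K_d)` — explicit in `L`; `θ = L⁻²` (below), `k` enters
only through `θ^k`.

## The located step where the PRINTED argument loses the rate (deliverable clause; prose, not a theorem)

B4's (5.10) AS PRINTED keeps only the common size `c₀` of `B` and of `A`: fed an operator rate `|A_{k+1} − A_k| ≤ ε_k e^{−δ₀|·|}`
it returns `c₁e^{−δ₁(…)}` with NO factor `ε_k` — no rate at all.  The one printed device that re-injects smallness, the
boundary weight of (5.9)/(5.10) (constant potential `ω ≡ t`, available in the abstract form `B4Sect5Torus.sect5_uniform`),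
converts `ε_k = c₀e^{−2δ₀t}` into `c₁e^{−2δ₁t} = c₁(ε_k/c₀)^{δ₁/δ₀}` — a HÖLDER transfer with exponent `δ⋆/δ₀ ≤ 1/16 < 1`
(`θ ↦ θ^{δ⋆/δ₀}`: still geometric, so the SHAPE of (CONV-C) survives even by the printed route, but the ratio degrades).
The paper's own identity (5.26) with the size of `B` carried through the proof (this file) gives the LINEAR transfer (same
`θ`).  So the printed argument loses the rate exactly at the absorption of `‖B‖` into `c₀` in the statement of (5.10); nothing
else in Sect. 5 is rate-lossy.  For the fine-lattice objects `G_k` ((1.83) of [Balaban1984PropagatorsI]) and `H_k` ((1.63))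
Sect. 5 gives NOTHING toward an η-rate: it is a theorem about ONE index set, while `G_k`, `G_{k+1}` live on lattices of
spacings `η`, `η/L`; their η-rates are momentum-space statements (tree: `B5G183Rate*`, `B5Hk163Rate*`, `T4G183StripRate`,
torus / strip, cell lineage t4-ne2) and reach the unit lattice only through `Q_k(·)Q_k*` sandwiches and the effective operator
`Δ_k = a_k − a_k²Q_kG_kQ_k*` — whose rate is then exactly the INPUT `OpFamilyRate` of this file.

(INSTANTIATION CENSUS for Bałaban's `C^{(k)}(𝟙)`: PART 2 header.)

NOT CLAIMED: any statement about Bałaban's actual kernels (no instantiation is performed here); the η-rates of `G_k`, `H_k`;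
the vertex constituents `V_b`, `V_{bb′}` of (CONV-C) (background derivatives — an2's `OneStepKernelFamily` sockets); (CONV-Π),
(CONV-β), `BetaPertH`, continuum, Clay.  Value = a kernel theorem turning B4's qualitative Sect. 5 perturbation statement into
a quantitative rate-transfer with displayed constants, in infinite volume; NOT summit progress.
-/

namespace Summit.QuantumFields.BalabanUV.Beta.GAN24.DirichletExhaustion

open Finset Real Matrix Filter Topology
open Literature.MathematicalPhysics.QuantumFieldTheory.Balaban1983to89
open B4Sect5Proof (cStar deltaStar delta1 latticeConst latticeConst_nonneg idxSum_le cStar_pos deltaStar_pos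
  delta1_pos delta1_le_delta0 bigConst isUnit_of_hyp56 inv_compress_decay inv_sub_inv_eq abs_mul3_apply_le
  sum_sum_le_of_factor exp_split)
open B4Sect5Exhaustion (K toMat compress_toMat finInv finInv_of_mem finInv_of_not_mem_left finInv_of_not_mem_right
  Hyp56Z cut coe_cut_subset limInv tendsto_limInv limInv_abs_le limInv_of_not_mem limInv_symm)

noncomputable section

variable {d N : ℕ}

/-! ## §0  STATEMENT FIRST — the hypothesis shapes and the target (CONV-C) shape, over B4's index set `ℤ^d × Fin N` -/

/-- [shape] **Operator-level closeness on `Ω`** (the SUPPLIER's currency): two unit-lattice kernels differ on `Ω × Ω` by at most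
`ε·e^{−δ₀|x−x′|}` (sup-distance of `ℤ^d`).  For the step pair `(A_k, A_{k+1})` with `ε = θ₀θ^k` this is the operator
η-rate; values off `Ω` are never read. -/
def OpClose (Ω : Set (Fin d → ℤ)) (A A' : K d N → K d N → ℝ) (ε δ₀ : ℝ) : Prop :=
  ∀ p q : K d N, p.1 ∈ Ω → q.1 ∈ Ω → |A' p q - A p q| ≤ ε * Real.exp (-(δ₀ * dist p.1 q.1))

/-- [shape] **A family of unit-lattice operators with `k`-UNIFORM (5.6) and a GEOMETRIC operator step-rate**: every `A k`
satisfies B4's (5.6) on `Ω` with the same `(γ₀, c₀, δ₀)` (`B4Sect5Exhaustion.Hyp56Z`), and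
`|A (k+1) − A k|(x,x′) ≤ θ₀·θ^k·e^{−δ₀|x−x′|}` on `Ω × Ω`. -/
structure OpFamilyRate (Ω : Set (Fin d → ℤ)) (A : ℕ → K d N → K d N → ℝ) (γ₀ c₀ δ₀ θ₀ θ : ℝ) : Prop where
  hyp56 : ∀ k, Hyp56Z Ω (A k) γ₀ c₀ δ₀
  step : ∀ k, OpClose Ω (A k) (A (k + 1)) (θ₀ * θ ^ k) δ₀

/-- [shape] **(CONV-C) for ONE family of unit-lattice kernels** (cell `BETA/AN2.md` §6, the two clauses verbatim for a constituent
`𝒦^{(k)}`): `k`-uniform exponential decay `|𝒦^{(k)}|(y,y′) ≤ C₄e^{−δ₄|y−y′|}` AND the geometric one-step rate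
`|𝒦^{(k+1)} − 𝒦^{(k)}|(y,y′) ≤ C₄θ^k e^{−δ₄|y−y′|}`, with ONE pair `(C₄, δ₄)`.  A predicate over the parameters — the
TARGET SHAPE of binder row G-an2-4 for a unit-lattice-indexed constituent; asserted of nothing by this definition. -/
def ConvC (C : ℕ → K d N → K d N → ℝ) (C₄ δ₄ θ : ℝ) : Prop :=
  (∀ k (p q : K d N), |C k p q| ≤ C₄ * Real.exp (-(δ₄ * dist p.1 q.1))) ∧
  (∀ k (p q : K d N), |C (k + 1) p q - C k p q| ≤ C₄ * θ ^ k * Real.exp (-(δ₄ * dist p.1 q.1)))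

/-! ## §1  The explicit rate constant -/

/-- THE RATE CONSTANT `rateConst = (2/γ₀)²·(N·K_d(δ₁/2))²` — B4's (5.10)-constant `bigConst` with the size `c₀` of the
perturbation divided out (`bigConst_eq_mul_rateConst`); a displayed function of `(d, N, γ₀, c₀, δ₀)` through
`B4Sect5Proof.delta1 = min{δ₀/4, γ₀/(2M₀+1)}` and `B4Sect5Proof.latticeConst d a = (2/(1 − e^{−a/d}))^d`. -/
def rateConst (d N : ℕ) (γ₀ c₀ δ₀ : ℝ) : ℝ :=
  2 / γ₀ * (2 / γ₀) * (N * latticeConst d (delta1 d N γ₀ c₀ δ₀ / 2)) *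
    (N * latticeConst d (delta1 d N γ₀ c₀ δ₀ / 2))

/-- `rateConst ≥ 0`. -/
theorem rateConst_nonneg (d N : ℕ) {γ₀ c₀ δ₀ : ℝ} (hγ : 0 < γ₀) (hc : 0 ≤ c₀) (hδ : 0 < δ₀) :
    0 ≤ rateConst d N γ₀ c₀ δ₀ := by
  unfold rateConst
  have := latticeConst_nonneg d (half_pos (delta1_pos d N hγ hc hδ)).le
  positivity

/-- B4's (5.8)/(5.10) constant is `c₀ · rateConst`: the perturbation size enters LINEARLY. -/
theorem bigConst_eq_mul_rateConst (d N : ℕ) (γ₀ c₀ δ₀ : ℝ) :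
    bigConst d N γ₀ c₀ δ₀ = c₀ * rateConst d N γ₀ c₀ δ₀ := by
  unfold bigConst rateConst; ring

/-! ## §2  FINITE VOLUME: the second resolvent identity with the SIZE of the perturbation kept (B4's literal objects) -/

section Finite

/-- **Rate transfer, finite volume, B4's literal objects.**  For a finite `Ω ⊂ ℤ^d`, two matrices `A, A′` on
`B4.Idx Ω N` both satisfying (5.6) with `(γ₀, c₀, δ₀)` and differing by at most `ε·e^{−δ₀|x−x′|}` entrywise, every pair of
Dirichlet compressions satisfies `|A_Λ⁻¹(x,x′) − A′_Λ⁻¹(x,x′)| ≤ rateConst·ε·e^{−δ⋆|x−x′|}`, `δ⋆ = deltaStar`, uniformly in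
`Λ ⊆ Ω`.  Mechanism: `A_Λ⁻¹ − A′_Λ⁻¹ = A_Λ⁻¹(A′_Λ − A_Λ)A′_Λ⁻¹` (the paper's (5.26), `B4Sect5Proof.inv_sub_inv_eq`), (5.7) for
the outer factors (`B4Sect5Proof.inv_compress_decay`), the uniform lattice sums (`B4Sect5Proof.idxSum_le`) — the proof of
`B4Sect5Proof.perturb_bound` with the middle bound `c₀e^{−δ₀(…)}` replaced by `εe^{−δ₀|x−x′|}`. -/
theorem perturb_rate {γ₀ c₀ δ₀ ε : ℝ} (hγ : 0 < γ₀) (hc : 0 ≤ c₀) (hδ : 0 < δ₀) (hε : 0 ≤ ε)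
    {Ω : Finset (Fin d → ℤ)} {A A' : Matrix (B4.Idx Ω N) (B4.Idx Ω N) ℝ} (hA : B4.Hyp56 Ω A γ₀ c₀ δ₀)
    (hA' : B4.Hyp56 Ω A' γ₀ c₀ δ₀)
    (hB : ∀ p q : B4.Idx Ω N,
      |A' p q - A p q| ≤ ε * Real.exp (-(δ₀ * dist (p.1 : Fin d → ℤ) (q.1 : Fin d → ℤ))))
    {Λ : Finset (Fin d → ℤ)} (h : Λ ⊆ Ω) (p q : B4.Idx Λ N) :
    |(B4.compress h A)⁻¹ p q - (B4.compress h A')⁻¹ p q| ≤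
      rateConst d N γ₀ c₀ δ₀ * ε *
        Real.exp (-(deltaStar d N γ₀ c₀ δ₀ * dist (p.1 : Fin d → ℤ) (q.1 : Fin d → ℤ))) := by
  set δ₁ := delta1 d N γ₀ c₀ δ₀ with hδ₁
  set c₁ : ℝ := 2 / γ₀ with hc₁
  set K₁ : ℝ := N * latticeConst d (δ₁ / 2) with hK₁
  set T := dist (p.1 : Fin d → ℤ) (q.1 : Fin d → ℤ) with hT
  have hδ₁pos : 0 < δ₁ := delta1_pos d N hγ hc hδ
  have hδ₁0 : 0 ≤ δ₁ := hδ₁pos.le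
  have hδ₁δ₀ : δ₁ ≤ δ₀ := delta1_le_delta0 d N γ₀ c₀ hδ
  have hc₁0 : 0 ≤ c₁ := by rw [hc₁]; positivity
  have hAΛ : B4.Hyp56 Λ (B4.compress h A) γ₀ c₀ δ₀ := B6GOmega.hyp56_compress h hγ.le hc hδ.le hA
  have hA'Λ : B4.Hyp56 Λ (B4.compress h A') γ₀ c₀ δ₀ := B6GOmega.hyp56_compress h hγ.le hc hδ.le hA'
  have entry : (B4.compress h A)⁻¹ p q - (B4.compress h A')⁻¹ p q =
      ((B4.compress h A)⁻¹ * (B4.compress h A' - B4.compress h A) * (B4.compress h A')⁻¹) p q := by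
    have e := inv_sub_inv_eq (isUnit_of_hyp56 hγ hAΛ) (isUnit_of_hyp56 hγ hA'Λ)
    have e' := congrFun (congrFun e p) q
    rw [Matrix.sub_apply] at e'
    exact e'
  rw [entry]
  refine (abs_mul3_apply_le _ _ _ p q).trans ?_
  set W := c₁ * ε * c₁ * Real.exp (-(δ₁ / 4 * T)) with hW
  have hW0 : 0 ≤ W := by rw [hW]; positivity
  have main := sum_sum_le_of_factor
    (fun (r : B4.Idx Λ N) (s : B4.Idx Λ N) =>
      |(B4.compress h A)⁻¹ p r| * |(B4.compress h A' - B4.compress h A) r s| * |(B4.compress h A')⁻¹ s q|)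
    (fun r : B4.Idx Λ N => Real.exp (-(δ₁ / 2 * dist (p.1 : Fin d → ℤ) (r.1 : Fin d → ℤ))))
    (fun s : B4.Idx Λ N => Real.exp (-(δ₁ / 2 * dist (q.1 : Fin d → ℤ) (s.1 : Fin d → ℤ))))
    (W := W) (Ka := K₁) (Kb := K₁) hW0 (fun r => (Real.exp_pos _).le) (fun s => (Real.exp_pos _).le)
    ?_ (idxSum_le (half_pos hδ₁pos) Λ _) (idxSum_le (half_pos hδ₁pos) Λ _)
  · refine main.trans (le_of_eq ?_)
    rw [hW]; unfold rateConst deltaStar; rw [← hδ₁, ← hK₁]; ring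
  intro r s
  have hX := inv_compress_decay hγ hc hδ hA h p r
  have hM : |(B4.compress h A' - B4.compress h A) r s| ≤
      ε * Real.exp (-(δ₀ * dist (r.1 : Fin d → ℤ) (s.1 : Fin d → ℤ))) := by
    rw [Matrix.sub_apply]
    simp only [B4.compress, Matrix.submatrix_apply]
    exact hB (B4.inclIdx h r) (B4.inclIdx h s)
  have hY := inv_compress_decay hγ hc hδ hA' h s q
  set D₁ := dist (p.1 : Fin d → ℤ) (r.1 : Fin d → ℤ) with hD₁
  set D₂ := dist (r.1 : Fin d → ℤ) (s.1 : Fin d → ℤ) with hD₂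
  set D₃ := dist (s.1 : Fin d → ℤ) (q.1 : Fin d → ℤ) with hD₃
  have hD₂0 : 0 ≤ D₂ := dist_nonneg
  have hD₁0 : 0 ≤ D₁ := dist_nonneg
  have hD₃0 : 0 ≤ D₃ := dist_nonneg
  have t2 : T ≤ D₁ + D₂ + D₃ := by
    have := dist_triangle (p.1 : Fin d → ℤ) (r.1 : Fin d → ℤ) (q.1 : Fin d → ℤ)
    have := dist_triangle (r.1 : Fin d → ℤ) (s.1 : Fin d → ℤ) (q.1 : Fin d → ℤ)
    rw [hT]; linarith
  have t3 : dist (q.1 : Fin d → ℤ) (s.1 : Fin d → ℤ) = D₃ := dist_comm _ _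
  have hTle : T ≤ 2 * (D₁ + D₂ + D₃) := by linarith
  have hsplit := exp_split hδ₁0 hδ₁δ₀ hD₂0 hTle
  calc |(B4.compress h A)⁻¹ p r| * |(B4.compress h A' - B4.compress h A) r s| * |(B4.compress h A')⁻¹ s q|
      ≤ c₁ * Real.exp (-(δ₁ * D₁)) * (ε * Real.exp (-(δ₀ * D₂))) * (c₁ * Real.exp (-(δ₁ * D₃))) := by
        apply mul_le_mul (mul_le_mul hX hM (abs_nonneg _) (by positivity)) hY (abs_nonneg _)
        positivity
    _ = c₁ * ε * c₁ * (Real.exp (-(δ₁ * D₁)) * Real.exp (-(δ₀ * D₂)) * Real.exp (-(δ₁ * D₃))) := by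
        ring
    _ ≤ c₁ * ε * c₁ *
        (Real.exp (-(δ₁ / 4 * T)) * Real.exp (-(δ₁ / 2 * D₁)) * Real.exp (-(δ₁ / 2 * D₃))) :=
        mul_le_mul_of_nonneg_left hsplit (by positivity)
    _ = W * Real.exp (-(δ₁ / 2 * D₁)) *
        Real.exp (-(δ₁ / 2 * dist (q.1 : Fin d → ℤ) (s.1 : Fin d → ℤ))) := by
        rw [t3, hW]; ring

end Finite

/-! ## §3  INFINITE VOLUME: the rate passes through B4's Dirichlet exhaustion `Λ ∩ [−n,n]^d ↗ Λ` (every `Λ ⊆ Ω ⊆ ℤ^d`) -/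

section Infinite

variable {Ω : Set (Fin d → ℤ)} {A A' : K d N → K d N → ℝ} {γ₀ c₀ δ₀ ε : ℝ}

/-- The rate transfer for the zero-extended finite-volume inverse kernels `C_Λ = A_Λ⁻¹` of a finite `Λ ⊆ Ω`
(`B4Sect5Exhaustion.finInv`), on ambient indices: `|C_Λ[A](x,x′) − C_Λ[A′](x,x′)| ≤ rateConst·ε·e^{−δ⋆|x−x′|}`. -/
theorem finInv_sub_finInv_rate (hγ : 0 < γ₀) (hc : 0 < c₀) (hδ : 0 < δ₀) (hε : 0 ≤ ε)
    (hA : Hyp56Z Ω A γ₀ c₀ δ₀) (hA' : Hyp56Z Ω A' γ₀ c₀ δ₀) (hB : OpClose Ω A A' ε δ₀)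
    (Λ : Finset (Fin d → ℤ)) (hΛ : (↑Λ : Set (Fin d → ℤ)) ⊆ Ω) (p q : K d N) :
    |finInv Λ A p q - finInv Λ A' p q| ≤
      rateConst d N γ₀ c₀ δ₀ * ε * Real.exp (-(deltaStar d N γ₀ c₀ δ₀ * dist p.1 q.1)) := by
  have hR0 : 0 ≤ rateConst d N γ₀ c₀ δ₀ * ε * Real.exp (-(deltaStar d N γ₀ c₀ δ₀ * dist p.1 q.1)) := by
    have := rateConst_nonneg d N hγ hc.le hδ
    positivity
  by_cases hp : p.1 ∈ Λ
  · by_cases hq : q.1 ∈ Λ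
    · rw [finInv_of_mem A hp hq, finInv_of_mem A' hp hq]
      have hBΛ : ∀ p' q' : B4.Idx Λ N, |toMat Λ A' p' q' - toMat Λ A p' q'| ≤
          ε * Real.exp (-(δ₀ * dist (p'.1 : Fin d → ℤ) (q'.1 : Fin d → ℤ))) :=
        fun p' q' => hB _ _ (hΛ p'.1.2) (hΛ q'.1.2)
      have h := perturb_rate hγ hc.le hδ hε (hA.hyp56 Λ hΛ) (hA'.hyp56 Λ hΛ) hBΛ (Finset.Subset.refl Λ)
        (⟨p.1, hp⟩, p.2) (⟨q.1, hq⟩, q.2)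
      rw [compress_toMat, compress_toMat] at h
      exact h
    · rw [finInv_of_not_mem_right A hq, finInv_of_not_mem_right A' hq, sub_zero, abs_zero]
      exact hR0
  · rw [finInv_of_not_mem_left A hp, finInv_of_not_mem_left A' hp, sub_zero, abs_zero]
    exact hR0

/-- **RATE TRANSFER IN INFINITE VOLUME (the Dirichlet exhaustion with an explicit rate).**  Let `A, A′` satisfy (5.6)
on an arbitrary `Ω ⊆ ℤ^d` with `(γ₀, c₀, δ₀)` and `|A′ − A|(x,x′) ≤ ε·e^{−δ₀|x−x′|}` on `Ω × Ω`.  Then for EVERY `Λ ⊆ Ω`,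
finite or infinite, B4's inverse kernels `C_Λ = limInv Λ ·` (entrywise limits of the Dirichlet compressions
`A_{Λ ∩ [−n,n]^d}⁻¹`, `B4Sect5Exhaustion.limInv`) satisfy
`|C_Λ[A](x,x′) − C_Λ[A′](x,x′)| ≤ rateConst·ε·e^{−δ⋆|x−x′|}` with the EXPLICIT `rateConst(d,N,γ₀,c₀,δ₀)` and
`δ⋆ = B4Sect5Proof.deltaStar`.  (The finite bound at every level of the exhaustion, then `le_of_tendsto'`.) -/
theorem limInv_sub_limInv_rate (hγ : 0 < γ₀) (hc : 0 < c₀) (hδ : 0 < δ₀) (hε : 0 ≤ ε)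
    (hA : Hyp56Z Ω A γ₀ c₀ δ₀) (hA' : Hyp56Z Ω A' γ₀ c₀ δ₀) (hB : OpClose Ω A A' ε δ₀)
    {Λ : Set (Fin d → ℤ)} (hΛ : Λ ⊆ Ω) (p q : K d N) :
    |limInv Λ A p q - limInv Λ A' p q| ≤
      rateConst d N γ₀ c₀ δ₀ * ε * Real.exp (-(deltaStar d N γ₀ c₀ δ₀ * dist p.1 q.1)) := by
  have h1 := tendsto_limInv hγ hc hδ (hA.mono hΛ) p q
  have h2 := tendsto_limInv hγ hc hδ (hA'.mono hΛ) p q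
  refine le_of_tendsto' (h1.sub h2).abs fun n => ?_
  exact finInv_sub_finInv_rate hγ hc hδ hε hA hA' hB (cut Λ n) ((coe_cut_subset Λ n).trans hΛ) p q

end Infinite

end

end Summit.QuantumFields.BalabanUV.Beta.GAN24.DirichletExhaustion
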